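import Literature.Analysis.FunctionSpaces.TorusIntegerEndomorphismCalculus
import Literature.Analysis.FunctionSpaces.TorusPlanarLift
import Literature.Analysis.FluidPDE.MikadoShiftedPipes
import Literature.Analysis.FluidPDE.NashRankOneDecomposition
import HarnessLib

/-!
# Pipe profiles around periodic lines of integer direction `(θ₁, θ₂, 1)` in `T³`
# (the cutoffs `φ̃_j` of Coiculescu–Palasek, §3.1)

Analysis/FluidPDE support file (definitions with proved API; no named facts) on the discharge path
of the named fact `Literature.Barriers.NavierStokesRegularity.CoiculescuPalasek2025_principalParts`.
In M. P. Coiculescu, S. Palasek, *Non-uniqueness of smooth solutions of the Navier–Stokes equations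
from critical data*, Invent. Math. 244 (2025), arXiv:2503.14699, §3.1, the Mikado potentials
`Ψ⁰_{j,k} = N_k⁻² φ̃_j(M_k x) sin(N_k(x - x_j)·η_j) θ_j` (Def. 3.1; `FluidPDE/MikadoShearPotential`) are cut
off by profiles "`φ̃_j(x) = φ(δ₀⁻¹ dist(x, ℓ_j)) 𝟙_{dist(x,ℓ_j) ≤ δ₀}` … interpreted as a function on
`𝕋³`", where `ℓ_j = x_j + θ_j ℝ` is the periodic line through `x_j` in the direction `θ_j ∈ ℤ³` of
the Nash lemma — so `φ̃_j` is a smooth function on `𝕋³`, constant along `θ_j`, concentrated in the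
`δ₀`-tube around `ℓ_j`. All six directions `θ_j` of the paper have third coordinate `1`
(`CP25.nashDir_apply_two`). For such a direction `θ = (θ₁, θ₂, 1)` the integer matrix

  `Φ = [[1, 0, -θ₁], [0, 1, -θ₂], [0, 0, 1]]`   (`CP25.pipeMatrix θ₁ θ₂`, `det Φ = 1`, `Φθ = e₃`)

is a Haar-preserving automorphism of `T³` straightening `ℓ` into a vertical line, and this file
realises the profiles as pull-backs of PLANAR profiles `ρ : T² → ℝ` (any smooth bump on the
2-torus; its choice — radius `δ₀`, `ρ = 1` near the centre — is left to the consumer):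

  `CP25.pipeProfile θ₁ θ₂ ρ x₀ (y) = ρ (π₁₂ (Φ • (y - x₀)))`   (`π₁₂ = Torus.planarProj`).

Proved API (the properties of `φ̃_j` used in Lemma 3.2 (3), Lemma 3.3 and Def. 3.5):
* smoothness (`CP25.isSmooth_pipeProfile`), value transfer (`CP25.pipeProfile_mem`);
* **constancy along `θ`**: `∑ᵢ θᵢ ∂ᵢ (pipeProfile …) ≡ 0` (`CP25.sum_mul_partialDeriv_pipeProfile_eq_zero`;
  chain rule along `Φ`, `Φθ = e₃`, and planar lifts do not depend on the third coordinate) — the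
  hypothesis `hθg` of `CP25.isDivFree_mikadoPotential` / `CP25.convect_mikadoPotential_self`, also in
  the shape `∑ᵢ (θ_j)ᵢ ∂ᵢ` for the Nash directions (`CP25.sum_mul_partialDeriv_pipeProfile_nash_eq_zero`);
* **measure**: `y ↦ π₁₂(Φ • (y - x₀))` preserves Haar measure (`CP25.measurePreserving_pipeMap`), so
  `∫_{T³} pipeProfile = ∫_{T²} ρ` (`CP25.integral_pipeProfile`) and level/support sets of the profile
  have the planar measure (`CP25.volume_preimage_pipeProfile`) — the inputs "`⨍ φ̃_j² ∼ δ`",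
  "`πδ₀² ∑|ℓ_j| ≤ δ`" of Lemma 3.2 (4) and (pipevolume);
* **Lipschitz constant of the lift** (`CP25.abs_pipeProfile_proj_sub_le`): if the lift of `ρ` is
  `L`-Lipschitz then the lift of the profile is `L‖Φ_ℝ‖`-Lipschitz — the hypothesis `hφL` of the
  nested-product volume lemma `integral_prod_comp_nsmul_le_pow` (`FluidPDE/NestedCutoffProducts`,
  Lemma 3.3).

Not here: the separation of the six tubes by the choice of the centres `x_j` (Lemma 3.2 (3),
display (pipesseparated)) and the choice of `ρ`.

## Mathlib / tree search

Reused: `Torus.mulVecT`, `measurePreserving_mulVecT`, `integral_comp_mulVecT_add`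
(`TorusIntegerEndomorphism`), `IsSmooth.comp_mulVecT`, `sum_mul_partialDeriv_comp_mulVecT`,
`mulVecT_proj_eq_toEuclideanCLM` (`TorusIntegerEndomorphismCalculus`), `Torus.planarProj`,
`IsSmooth/IsContDiff.comp_planarProj`, `partialDeriv_comp_planarProj_last`,
`measurePreserving_planarProj`, `integral_comp_planarProj`, `planarProj_proj`, `norm_planarProjE_le`
(`TorusPlanarLift`), `Mikado.isSmooth_comp_sub`, `Mikado.partialDeriv_comp_sub`,
`Mikado.integral_comp_sub` (`MikadoShiftedPipes`), `CP25.nashDir`, `CP25.nashDir_apply_two`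
(`NashRankOneDecomposition`). The tree's `TransverseDatum` (`TransversePullback`) requires orthogonal
integer rows with an integer section, which the directions `(1,1,1)`, `(-1,1,1)` of the paper do not
admit; hence the unimodular-matrix route. `lean search 'pipeProfile|pipeMatrix'`: no prior declarations.

## References

* M. P. Coiculescu, S. Palasek, Invent. Math. 244 (2025) 165–219, doi:10.1007/s00222-025-01396-z,
  arXiv:2503.14699: §3.1 (the profiles `φ̃_j`, (pipevolume)), Lemma 3.2 (3)–(4), Lemma 3.3 (proof).
  [CoiculescuPalasek2025]
* S. Daneri, L. Székelyhidi Jr., Arch. Ration. Mech. Anal. 224 (2017) 471–514, Lemma 2.3.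
  [DaneriSzekelyhidi2017]
-/

noncomputable section

open MeasureTheory Set Function UnitAddTorus
open scoped BigOperators

namespace Literature.Analysis.FluidPDE

namespace CP25

open Literature.Analysis.FunctionSpaces Literature.Analysis.FunctionSpaces.Torus

/-! ## The straightening matrix `Φ` -/

/-- **The straightening matrix of the direction `θ = (θ₁, θ₂, 1)`**:
`Φ = [[1, 0, -θ₁], [0, 1, -θ₂], [0, 0, 1]] ∈ SL₃(ℤ)`, mapping `θ` to `e₃`.
[cite: CoiculescuPalasek2025, §3.1 (the lines `ℓ_j = x_j + θ_jℝ`)] -/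
def pipeMatrix (θ₁ θ₂ : ℤ) : Matrix (Fin 3) (Fin 3) ℤ := !![1, 0, -θ₁; 0, 1, -θ₂; 0, 0, 1]

/-- `det Φ = 1`. [folklore] -/
theorem det_pipeMatrix (θ₁ θ₂ : ℤ) : (pipeMatrix θ₁ θ₂).det = 1 := by
  simp [pipeMatrix, Matrix.det_fin_three]

/-- `det Φ ≠ 0`. [folklore] -/
theorem det_pipeMatrix_ne_zero (θ₁ θ₂ : ℤ) : (pipeMatrix θ₁ θ₂).det ≠ 0 := by
  rw [det_pipeMatrix]; exact one_ne_zero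

/-- **`Φθ = e₃`** for `θ = (θ₁, θ₂, 1)`. [folklore] -/
theorem pipeMatrix_mulVec_dir (θ₁ θ₂ : ℤ) :
    (pipeMatrix θ₁ θ₂).mulVec ![θ₁, θ₂, 1] = ![0, 0, 1] := by
  ext i
  fin_cases i <;> simp [pipeMatrix, Matrix.mulVec, dotProduct, Fin.sum_univ_three]

/-! ## The profiles -/

section Basic

variable {F : Type*}

/-- **Pipe profile around the periodic line `x₀ + (θ₁, θ₂, 1)ℝ`**: the pull-back
`y ↦ ρ(π₁₂(Φ • (y - x₀)))` of a planar profile `ρ : T² → F` (the cutoffs `φ̃_j` of §3.1, with the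
radial choice of `ρ` left open). [cite: CoiculescuPalasek2025, §3.1 (definition of `φ̃_j`)] -/
def pipeProfile (θ₁ θ₂ : ℤ) (ρ : UnitAddTorus (Fin 2) → F) (x₀ : UnitAddTorus (Fin 3))
    (y : UnitAddTorus (Fin 3)) : F :=
  ρ (planarProj (mulVecT (pipeMatrix θ₁ θ₂) (y - x₀)))

/-- Unfolding. [folklore] -/
theorem pipeProfile_apply (θ₁ θ₂ : ℤ) (ρ : UnitAddTorus (Fin 2) → F) (x₀ y : UnitAddTorus (Fin 3)) :
    pipeProfile θ₁ θ₂ ρ x₀ y = ρ (planarProj (mulVecT (pipeMatrix θ₁ θ₂) (y - x₀))) := rfl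

/-- The profile as a composition: translate, straighten, project, apply `ρ`. [folklore] -/
theorem pipeProfile_eq_comp (θ₁ θ₂ : ℤ) (ρ : UnitAddTorus (Fin 2) → F) (x₀ : UnitAddTorus (Fin 3)) :
    pipeProfile θ₁ θ₂ ρ x₀ =
      fun y => ((ρ ∘ planarProj) ∘ mulVecT (pipeMatrix θ₁ θ₂)) (y - x₀) := rfl

/-- Values of the profile are values of `ρ` (so `0 ≤ φ̃ ≤ 1`, `φ̃ = 1` on the line, … transfer).
[folklore] -/
theorem pipeProfile_mem {θ₁ θ₂ : ℤ} {ρ : UnitAddTorus (Fin 2) → F} {S : Set F}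
    (hρ : ∀ z, ρ z ∈ S) (x₀ y : UnitAddTorus (Fin 3)) : pipeProfile θ₁ θ₂ ρ x₀ y ∈ S :=
  hρ _

/-- At the centre the profile takes the central value `ρ 0`. [folklore] -/
theorem pipeProfile_apply_center (θ₁ θ₂ : ℤ) (ρ : UnitAddTorus (Fin 2) → F)
    (x₀ : UnitAddTorus (Fin 3)) : pipeProfile θ₁ θ₂ ρ x₀ x₀ = ρ 0 := by
  rw [pipeProfile_apply, sub_self, map_zero]
  rfl

end Basic

section Smooth

variable {F : Type*} [NormedAddCommGroup F] [NormedSpace ℝ F]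

/-- **Smoothness**: the profile is smooth for a smooth planar profile.
[cite: CoiculescuPalasek2025, §3.1 ("`φ̃_j` should be interpreted as a function on `𝕋³`")] -/
theorem isSmooth_pipeProfile (θ₁ θ₂ : ℤ) {ρ : UnitAddTorus (Fin 2) → F} (hρ : IsSmooth ρ)
    (x₀ : UnitAddTorus (Fin 3)) : IsSmooth (pipeProfile θ₁ θ₂ ρ x₀) := by
  rw [pipeProfile_eq_comp]
  exact Mikado.isSmooth_comp_sub ((hρ.comp_planarProj).comp_mulVecT _) x₀

/-- `C^n` version of `isSmooth_pipeProfile`. [folklore] -/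
theorem isContDiff_pipeProfile {n : WithTop ℕ∞} (θ₁ θ₂ : ℤ) {ρ : UnitAddTorus (Fin 2) → F}
    (hρ : IsContDiff n ρ) (x₀ : UnitAddTorus (Fin 3)) : IsContDiff n (pipeProfile θ₁ θ₂ ρ x₀) := by
  rw [pipeProfile_eq_comp]
  exact Mikado.isContDiff_comp_sub ((hρ.comp_planarProj).comp_mulVecT _) x₀

/-! ## Constancy along the direction -/

/-- **The profile is constant along `θ = (θ₁, θ₂, 1)`**: `∑ᵢ θᵢ ∂ᵢ φ̃ ≡ 0` for a `C¹` planar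
profile (the derivative of the pull-back along `θ` is the derivative of `ρ ∘ π₁₂` along `Φθ = e₃`,
which vanishes). [cite: CoiculescuPalasek2025, §3.1 and Lemma 3.2 (2) (proof)] -/
theorem sum_mul_partialDeriv_pipeProfile_eq_zero (θ₁ θ₂ : ℤ) {ρ : UnitAddTorus (Fin 2) → ℝ}
    (hρ : IsContDiff 1 ρ) (x₀ y : UnitAddTorus (Fin 3)) :
    ∑ i, ((![θ₁, θ₂, 1] : Fin 3 → ℤ) i : ℝ) * partialDeriv i (pipeProfile θ₁ θ₂ ρ x₀) y = 0 := by
  have h1 : ∀ i, partialDeriv i (pipeProfile θ₁ θ₂ ρ x₀) y =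
      partialDeriv i ((ρ ∘ planarProj) ∘ mulVecT (pipeMatrix θ₁ θ₂)) (y - x₀) := by
    intro i
    rw [pipeProfile_eq_comp, Mikado.partialDeriv_comp_sub]
  simp_rw [h1]
  rw [sum_mul_partialDeriv_comp_mulVecT hρ.comp_planarProj (pipeMatrix θ₁ θ₂) ![θ₁, θ₂, 1]
    (y - x₀), pipeMatrix_mulVec_dir]
  have hlast : ∀ z, partialDeriv (2 : Fin 3) (ρ ∘ planarProj) z = 0 := by
    intro z
    have h := partialDeriv_comp_planarProj_last ρ
    rw [show (Fin.last 2 : Fin 3) = 2 from rfl] at h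
    rw [h]
    rfl
  simp [Fin.sum_univ_three, hlast]

/-! ## The paper's directions -/

/-- `θ_j = (θ_{j,1}, θ_{j,2}, 1)`: every Nash direction is of the straightenable form.
[cite: CoiculescuPalasek2025, Lemma 6.1 (proof)] -/
theorem nashDir_eq_vec (j : Fin 6) : nashDir j = ![nashDir j 0, nashDir j 1, 1] := by
  funext i
  fin_cases i
  · rfl
  · rfl
  · exact nashDir_apply_two j

/-- **The profiles of the paper are constant along `θ_j`**:
`∑ᵢ (θ_j)ᵢ ∂ᵢ (pipeProfile (θ_j)₁ (θ_j)₂ ρ x_j) ≡ 0` — the hypothesis `hθg` of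
`CP25.isDivFree_mikadoPotential_nash` / `CP25.convect_mikadoPotential_nash_self`.
[cite: CoiculescuPalasek2025, §3.1 and Lemma 3.2 (2)] -/
theorem sum_mul_partialDeriv_pipeProfile_nash_eq_zero (j : Fin 6) {ρ : UnitAddTorus (Fin 2) → ℝ}
    (hρ : IsContDiff 1 ρ) (x₀ y : UnitAddTorus (Fin 3)) :
    ∑ i, (nashDir j i : ℝ) * partialDeriv i (pipeProfile (nashDir j 0) (nashDir j 1) ρ x₀) y = 0 := by
  have h := sum_mul_partialDeriv_pipeProfile_eq_zero (nashDir j 0) (nashDir j 1) hρ x₀ y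
  rw [← nashDir_eq_vec j] at h
  exact h

end Smooth

/-! ## Measure: the straightening map preserves Haar measure -/

section Measure

variable {F : Type*} [NormedAddCommGroup F] [NormedSpace ℝ F]

/-- **`y ↦ π₁₂(Φ • (y - x₀))` is measure preserving `T³ → T²`** (translation, an `SL₃(ℤ)`
automorphism, and the coordinate projection all preserve Haar measure). [folklore] -/
theorem measurePreserving_pipeMap (θ₁ θ₂ : ℤ) (x₀ : UnitAddTorus (Fin 3)) :
    MeasurePreserving (fun y : UnitAddTorus (Fin 3) => planarProj (mulVecT (pipeMatrix θ₁ θ₂) (y - x₀)))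
      volume volume :=
  measurePreserving_planarProj.comp
    ((measurePreserving_mulVecT (det_pipeMatrix_ne_zero θ₁ θ₂)).comp
      (measurePreserving_sub_right volume x₀))

/-- **`∫_{T³} φ̃ = ∫_{T²} ρ`**: the integral of a pipe profile is the planar integral of its profile
(in the paper: `‖φ̃_j‖_{L¹}`, `⨍ φ̃_j² ∼ δ` are planar quantities `∼ πδ₀²`).
[cite: CoiculescuPalasek2025, §3.1 (pipevolume) and Lemma 3.2 (4)] -/
theorem integral_pipeProfile (θ₁ θ₂ : ℤ) {ρ : UnitAddTorus (Fin 2) → F}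
    (hρ : AEStronglyMeasurable ρ volume) (x₀ : UnitAddTorus (Fin 3)) :
    ∫ y, pipeProfile θ₁ θ₂ ρ x₀ y = ∫ z, ρ z := by
  have h := measurePreserving_pipeMap θ₁ θ₂ x₀
  have hρ' : AEStronglyMeasurable ρ
      (Measure.map (fun y : UnitAddTorus (Fin 3) => planarProj (mulVecT (pipeMatrix θ₁ θ₂) (y - x₀)))
        volume) := by
    rw [h.map_eq]; exact hρ
  have h2 := integral_map h.measurable.aemeasurable hρ'
  rw [h.map_eq] at h2
  exact h2.symm

/-- **Level sets of a pipe profile have the planar measure**: for measurable `ρ` and a measurable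
set of values `S`, `vol_{T³} {y : φ̃(y) ∈ S} = vol_{T²} {z : ρ(z) ∈ S}` (volumes of tubes
`{φ̃ ≠ 0}`, `{φ̃ = 1}`, … are areas of discs). [cite: CoiculescuPalasek2025, §3.1 (pipevolume)] -/
theorem volume_preimage_pipeProfile (θ₁ θ₂ : ℤ) {ρ : UnitAddTorus (Fin 2) → ℝ} (hρ : Measurable ρ)
    {S : Set ℝ} (hS : MeasurableSet S) (x₀ : UnitAddTorus (Fin 3)) :
    volume {y | pipeProfile θ₁ θ₂ ρ x₀ y ∈ S} = volume {z : UnitAddTorus (Fin 2) | ρ z ∈ S} := by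
  have h := measurePreserving_pipeMap θ₁ θ₂ x₀
  have hT : MeasurableSet {z : UnitAddTorus (Fin 2) | ρ z ∈ S} := hρ hS
  have h2 := h.measure_preimage hT.nullMeasurableSet
  exact h2

end Measure

/-! ## The Lipschitz constant of the lift -/

section Lipschitz

variable {F : Type*}

/-- The lift of the profile through the covering map: for `x₀ = proj X₀`,
`φ̃(proj y) = ρ(proj(π(Φ_ℝ(y - X₀))))`. [folklore] -/
theorem pipeProfile_proj (θ₁ θ₂ : ℤ) (ρ : UnitAddTorus (Fin 2) → F) (X₀ y : EuclideanSpace ℝ (Fin 3)) :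
    pipeProfile θ₁ θ₂ ρ (proj X₀) (proj y) =
      ρ (proj (planarProjE
        (Matrix.toEuclideanCLM (n := Fin 3) (𝕜 := ℝ) ((pipeMatrix θ₁ θ₂).map (Int.cast : ℤ → ℝ))
          (y - X₀)))) := by
  have hsub : proj y - proj X₀ = proj (y - X₀) := by
    rw [sub_eq_add_neg, ← proj_neg, ← proj_add, ← sub_eq_add_neg]
  rw [pipeProfile_apply, hsub, mulVecT_proj_eq_toEuclideanCLM, planarProj_proj]

/-- **Lipschitz constant of the lifted profile**: if the lift of `ρ` is `L`-Lipschitz then the lift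
of `pipeProfile θ₁ θ₂ ρ x₀` is `L‖Φ_ℝ‖`-Lipschitz (`‖π₁₂‖ ≤ 1`), in the shape of the hypothesis `hφL`
of `integral_prod_comp_nsmul_le_pow` (`NestedCutoffProducts`).
[cite: CoiculescuPalasek2025, Lemma 3.3 (proof: "`|∇φ| ≤ C'δ₀⁻¹`")] -/
theorem abs_pipeProfile_proj_sub_le (θ₁ θ₂ : ℤ) {ρ : UnitAddTorus (Fin 2) → ℝ} {L : ℝ} (hL : 0 ≤ L)
    (hρL : ∀ z z' : EuclideanSpace ℝ (Fin 2), |ρ (proj z) - ρ (proj z')| ≤ L * ‖z - z'‖)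
    (x₀ : UnitAddTorus (Fin 3)) (y y' : EuclideanSpace ℝ (Fin 3)) :
    |pipeProfile θ₁ θ₂ ρ x₀ (proj y) - pipeProfile θ₁ θ₂ ρ x₀ (proj y')| ≤
      L * ‖Matrix.toEuclideanCLM (n := Fin 3) (𝕜 := ℝ) ((pipeMatrix θ₁ θ₂).map (Int.cast : ℤ → ℝ))‖ *
        ‖y - y'‖ := by
  obtain ⟨X₀, rfl⟩ := proj_surjective x₀
  set Φ := Matrix.toEuclideanCLM (n := Fin 3) (𝕜 := ℝ) ((pipeMatrix θ₁ θ₂).map (Int.cast : ℤ → ℝ))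
    with hΦ
  rw [pipeProfile_proj, pipeProfile_proj, ← hΦ]
  refine (hρL _ _).trans ?_
  have h1 : planarProjE (Φ (y - X₀)) - planarProjE (Φ (y' - X₀)) = planarProjE (Φ (y - y')) := by
    rw [← map_sub, ← map_sub]
    congr 1
    abel
  rw [h1, mul_assoc]
  refine mul_le_mul_of_nonneg_left ?_ hL
  exact (norm_planarProjE_le _).trans (Φ.le_opNorm _)

end Lipschitz

end CP25

end Literature.Analysis.FluidPDE
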